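import Summits.RiemannHypothesis.RiemannHypothesis.Theorems.WeilBochnerMeasureGrowth
import Summits.RiemannHypothesis.RiemannHypothesis.Theorems.WeilFormatCWindowClosure
import Summits.RiemannHypothesis.RiemannHypothesis.Theorems.WeilFormatCEntrySesq
import Mathlib.Analysis.Complex.RealDeriv
import HarnessLib

/-!
# RiemannHypothesis — the Bochner–Kreĭn measure represents the window form on Yoshida's window functions

Helper file (`--supports stmt-RiemannHypothesis-0098`), RH-free, standard axioms.  Seat rh-explicit
weil-3 (structure).

Let `a > 0` and let `μ` be ANY positive measure representing Weil's form on `C(a)`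
(`W(g ⋆ g̃) = ∫ ‖ĝ(½+it)‖² dμ` for all tests `g` supported in `[-a, a]`; such `μ` exist iff
`WeilPositivityOn a`, `WeilBochner.weilPositivityOn_iff_exists_measure`).  Then the identity extends from
`C(a)` to every WINDOW FUNCTION `u` that is smooth inside the closed window (jumps at `±a` allowed — Yoshida's
space `K(a)`, the trigonometric windows `Σ c_n χ_n` of format C):

  `weilWindowForm a u = ∫ ‖û(½+it)‖² dμ(t)`,  `‖û(½+it)‖² ∈ L¹(μ)`   (`weilWindowForm_eq_integral`).

Consequently (`sum_mul_mul_gramCoeff_eq_integral`) **Yoshida's Gram matrix is a moment matrix of `μ`**: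
`Σ_{n,m} x_n x_m G(n,m) = ∫ |Σ_n x_n χ̂_n(½+it)|² dμ(t)` for every real coefficient vector — the
format-C certificates test the positivity of a would-be spectral measure against the window's
trigonometric system (shifted `sinc` kernels on the critical line), i.e. each truncation is a finite
MOMENT PROBLEM for `μ`.

Proof.  Cut `u` off smoothly inside the window exactly as in `WeilFormatCWindowClosure`
(`g_k = η_k · u ∈ C(a)`, plateaus `η_k` of transition width `ε_k → 0`): (Q-side, tree)
`weilWindowForm a g_k → weilWindowForm a u` (`tendsto_weilWindowForm_of_ae_tendsto_of_le` with the uniform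
increment bound `weilIncrement_cutoff_le`); (μ-side, here) `ĝ_k(½+it) → û(½+it)` pointwise and
`‖ĝ_k(½+it)‖ ≤ min(2aS₀, V/|t|)` UNIFORMLY in `k`, where `V = 4CS₀ + 2a‖f′‖_∞` bounds `∫ ‖g_k′‖`
(`η_k′` lives on two annuli of width `ε_k` where `|η_k′| ≤ 2C/ε_k`), so `‖ĝ_k‖² ≤ B (1+t²)⁻¹ ∈ L¹(μ)` by the
growth law (`integrable_inv_one_add_sq`) and dominated convergence applies; for each `k`,
`weilWindowForm a g_k = Re Q(g_k) = ∫ ‖ĝ_k‖² dμ`.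
-/

noncomputable section

set_option linter.dupNamespace false  -- the mandated namespace repeats `RiemannHypothesis`

open Complex Filter Set MeasureTheory
open scoped Real Topology ContDiff ComplexConjugate
open Literature.NumberTheory.LFunctions
open Summit.RiemannHypothesis.RiemannHypothesis.Theorems.WeilFormatC

namespace Summit.RiemannHypothesis.RiemannHypothesis.Theorems.WeilBochnerMeasure

variable {a : ℝ}

/-! ## The cut-off approximants `η · f` and the `L¹` norm of their derivative -/

/-- A plateau that is constant near `x` has zero derivative there: if `η = 1` on `{|y| ≤ a − 2ε}` and
`η = 0` on `{a − ε ≤ |y|}`, then `deriv η x = 0` unless `a − 2ε ≤ |x| ≤ a − ε`. -/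
theorem deriv_plateau_eq_zero {η : ℝ → ℝ} {ε : ℝ} (hη1 : ∀ x, |x| ≤ a - 2 * ε → η x = 1)
    (hη0 : ∀ x, a - ε ≤ |x| → η x = 0) {x : ℝ} (hx : |x| < a - 2 * ε ∨ a - ε < |x|) : deriv η x = 0 := by
  rcases hx with hx | hx
  · have hev : η =ᶠ[𝓝 x] fun _ ↦ (1 : ℝ) :=
      Filter.eventually_of_mem ((isOpen_Iio.preimage continuous_abs).mem_nhds hx) fun y hy ↦ hη1 y (le_of_lt hy)
    rw [hev.deriv_eq, deriv_const]
  · have hev : η =ᶠ[𝓝 x] fun _ ↦ (0 : ℝ) :=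
      Filter.eventually_of_mem ((isOpen_Ioi.preimage continuous_abs).mem_nhds hx) fun y hy ↦ hη0 y (le_of_lt hy)
    rw [hev.deriv_eq, deriv_const]

/-- **`L¹` bound for the derivative of a cut-off approximant.**  Let `η` be a plateau of transition width
`ε` (`0 < 2ε ≤ a`; `0 ≤ η ≤ 1`, `η = 1` on `|x| ≤ a − 2ε`, `η = 0` on `|x| ≥ a − ε`, Lipschitz constant `K`)
and `f` differentiable with `‖f‖ ≤ S₀`, `‖f′‖ ≤ D` on `[-a, a]`.  Then
`∫ ‖(η·f)′‖ ≤ K S₀ · 2ε + D · 2a` (`η′` is supported on two annuli of width `ε`). -/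
theorem integral_norm_deriv_cutoff_le {η : ℝ → ℝ} {f : ℝ → ℂ} {ε K S₀ D : ℝ} (hε : 0 < ε)
    (h2ε : 2 * ε ≤ a) (hηd : Differentiable ℝ η) (hη01 : ∀ x, 0 ≤ η x ∧ η x ≤ 1)
    (hη1 : ∀ x, |x| ≤ a - 2 * ε → η x = 1) (hη0 : ∀ x, a - ε ≤ |x| → η x = 0) (hK : 0 ≤ K)
    (hηL : ∀ x y, |η x - η y| ≤ K * |x - y|) (hf : Differentiable ℝ f)
    (hS₀ : ∀ x ∈ Icc (-a) a, ‖f x‖ ≤ S₀) (hD : ∀ x ∈ Icc (-a) a, ‖deriv f x‖ ≤ D)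
    (hint : Integrable fun x ↦ ‖deriv (fun x ↦ (η x : ℂ) * f x) x‖) :
    ∫ x, ‖deriv (fun x ↦ (η x : ℂ) * f x) x‖ ≤ K * S₀ * (2 * ε) + D * (2 * a) := by
  have hS₀0 : 0 ≤ S₀ := (norm_nonneg _).trans (hS₀ 0 (by constructor <;> linarith))
  have hD0 : 0 ≤ D := (norm_nonneg _).trans (hD 0 (by constructor <;> linarith))
  -- the derivative and its pointwise bound
  have hderiv : ∀ x, deriv (fun x ↦ (η x : ℂ) * f x) x =
      ((deriv η x : ℝ) : ℂ) * f x + (η x : ℂ) * deriv f x := fun x ↦ by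
    have h : HasDerivAt (fun y ↦ (η y : ℂ) * f y) (((deriv η x : ℝ) : ℂ) * f x + (η x : ℂ) * deriv f x) x :=
      ((hηd x).hasDerivAt.ofReal_comp).mul (hf x).hasDerivAt
    exact h.deriv
  have hηK : ∀ x, |deriv η x| ≤ K := fun x ↦ by
    have hlip : LipschitzWith (Real.toNNReal K) η := LipschitzWith.of_dist_le_mul fun x y ↦ by
      rw [Real.dist_eq, Real.dist_eq, Real.coe_toNNReal _ hK]; exact hηL x y
    have := norm_deriv_le_of_lipschitz (x₀ := x) hlip
    rwa [Real.norm_eq_abs, Real.coe_toNNReal _ hK] at this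
  set A₁ : Set ℝ := Icc (-(a - ε)) (-(a - 2 * ε)) with hA₁
  set A₂ : Set ℝ := Icc (a - 2 * ε) (a - ε) with hA₂
  set W : Set ℝ := Icc (-a) a with hW
  have hbound : ∀ x, ‖deriv (fun x ↦ (η x : ℂ) * f x) x‖ ≤
      K * S₀ * (A₁.indicator 1 x + A₂.indicator 1 x) + D * W.indicator 1 x := by
    intro x
    rw [hderiv]
    refine (norm_add_le _ _).trans (add_le_add ?_ ?_)
    · -- the `η′ f` term lives on the annuli
      rw [norm_mul, Complex.norm_real, Real.norm_eq_abs]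
      by_cases hx : a - 2 * ε ≤ |x| ∧ |x| ≤ a - ε
      · have hxW : x ∈ W := by rw [hW, mem_Icc, ← abs_le]; linarith [hx.2]
        have hind : (1 : ℝ) ≤ A₁.indicator 1 x + A₂.indicator 1 x := by
          have i1 : 0 ≤ A₁.indicator (1 : ℝ → ℝ) x := Set.indicator_nonneg (fun _ _ ↦ zero_le_one) x
          have i2 : 0 ≤ A₂.indicator (1 : ℝ → ℝ) x := Set.indicator_nonneg (fun _ _ ↦ zero_le_one) x
          rcases le_or_gt 0 x with h0 | h0
          · rw [abs_of_nonneg h0] at hx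
            have : x ∈ A₂ := ⟨hx.1, hx.2⟩
            rw [indicator_of_mem this, Pi.one_apply]
            linarith
          · rw [abs_of_neg h0] at hx
            have : x ∈ A₁ := ⟨by linarith [hx.2], by linarith [hx.1]⟩
            rw [indicator_of_mem this, Pi.one_apply]
            linarith
        calc |deriv η x| * ‖f x‖ ≤ K * S₀ := mul_le_mul (hηK x) (hS₀ x hxW) (norm_nonneg _) hK
          _ = K * S₀ * 1 := (mul_one _).symm
          _ ≤ K * S₀ * (A₁.indicator 1 x + A₂.indicator 1 x) := by gcongr
      · rw [not_and_or, not_le, not_le] at hx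
        rw [deriv_plateau_eq_zero hη1 hη0 hx, abs_zero, zero_mul]
        have i1 : 0 ≤ A₁.indicator (1 : ℝ → ℝ) x := Set.indicator_nonneg (fun _ _ ↦ zero_le_one) x
        have i2 : 0 ≤ A₂.indicator (1 : ℝ → ℝ) x := Set.indicator_nonneg (fun _ _ ↦ zero_le_one) x
        exact mul_nonneg (mul_nonneg hK hS₀0) (add_nonneg i1 i2)
    · -- the `η f′` term lives on the window
      rw [norm_mul, Complex.norm_real, Real.norm_eq_abs, abs_of_nonneg (hη01 x).1]
      by_cases hxW : x ∈ W
      · rw [indicator_of_mem hxW, Pi.one_apply, mul_one]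
        calc η x * ‖deriv f x‖ ≤ 1 * D := mul_le_mul (hη01 x).2 (hD x hxW) (norm_nonneg _) zero_le_one
          _ = D := one_mul _
      · have hxa : a - ε ≤ |x| := by
          have : a < |x| := lt_abs_of_not_mem_Icc_window hxW
          linarith
        rw [hη0 x hxa, zero_mul, indicator_of_notMem hxW, mul_zero]
  have hI : ∀ c d : ℝ, Integrable fun x : ℝ ↦ (Icc c d).indicator (1 : ℝ → ℝ) x := fun c d ↦
    (integrable_indicator_iff measurableSet_Icc).2 (integrableOn_const (by simp [Real.volume_Icc]))
  have hI12 : Integrable fun x ↦ A₁.indicator (1 : ℝ → ℝ) x + A₂.indicator (1 : ℝ → ℝ) x :=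
    (hI _ _).add (hI _ _)
  have hL : Integrable fun x ↦ K * S₀ * (A₁.indicator (1 : ℝ → ℝ) x + A₂.indicator (1 : ℝ → ℝ) x) :=
    hI12.const_mul _
  have hR : Integrable fun x ↦ D * W.indicator (1 : ℝ → ℝ) x := (hI _ _).const_mul _
  have hrhs : Integrable fun x ↦ K * S₀ * (A₁.indicator 1 x + A₂.indicator 1 x) + D * W.indicator 1 x :=
    hL.add hR
  have e1 : ∫ x, K * S₀ * (A₁.indicator (1 : ℝ → ℝ) x + A₂.indicator 1 x) + D * W.indicator 1 x =
      (∫ x, K * S₀ * (A₁.indicator (1 : ℝ → ℝ) x + A₂.indicator 1 x)) + ∫ x, D * W.indicator (1 : ℝ → ℝ) x :=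
    integral_add hL hR
  have e2 : ∫ x, K * S₀ * (A₁.indicator (1 : ℝ → ℝ) x + A₂.indicator 1 x) =
      K * S₀ * ((∫ x, A₁.indicator (1 : ℝ → ℝ) x) + ∫ x, A₂.indicator (1 : ℝ → ℝ) x) := by
    rw [integral_const_mul]
    congr 1
    exact integral_add (hI _ _) (hI _ _)
  have e3 : ∫ x, D * W.indicator (1 : ℝ → ℝ) x = D * ∫ x, W.indicator (1 : ℝ → ℝ) x :=
    integral_const_mul _ _
  have v1 : ∫ x, A₁.indicator (1 : ℝ → ℝ) x = ε := by
    rw [hA₁, integral_indicator_one measurableSet_Icc, Real.volume_real_Icc_of_le (by linarith)]; ring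
  have v2 : ∫ x, A₂.indicator (1 : ℝ → ℝ) x = ε := by
    rw [hA₂, integral_indicator_one measurableSet_Icc, Real.volume_real_Icc_of_le (by linarith)]; ring
  have v3 : ∫ x, W.indicator (1 : ℝ → ℝ) x = 2 * a := by
    rw [hW, integral_indicator_one measurableSet_Icc, Real.volume_real_Icc_of_le (by linarith)]; ring
  calc ∫ x, ‖deriv (fun x ↦ (η x : ℂ) * f x) x‖
      ≤ ∫ x, K * S₀ * (A₁.indicator 1 x + A₂.indicator 1 x) + D * W.indicator 1 x :=
        integral_mono hint hrhs hbound
    _ = K * S₀ * (2 * ε) + D * (2 * a) := by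
        rw [e1, e2, e3, v1, v2, v3]; ring

/-! ## The window form is represented by `μ` on every smooth-inside window function -/

/-- **The Bochner–Kreĭn measure represents the window form on Yoshida's window functions.**  Let `a > 0`
and let `μ` represent Weil's form on the tests supported in `[-a, a]`
(`‖ĝ(½+it)‖² ∈ L¹(μ)`, `W(g ⋆ g̃) = ∫ ‖ĝ(½+it)‖² dμ`).  Then for every window function `u` on `[-a, a]`
(measurable, `0` off the window, bounded, Lipschitz on the closed window) that agrees on `[-a, a]` with a
smooth `f` — jumps at `±a` allowed — the transform density `‖û(½+it)‖²` is `μ`-integrable and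

  `weilWindowForm a u = ∫ ‖û(½+it)‖² dμ(t)`. -/
theorem weilWindowForm_eq_integral (ha : 0 < a) {μ : Measure ℝ}
    (hμ : ∀ g : ℝ → ℂ, IsWeilTest g → tsupport g ⊆ Icc (-a) a →
      Integrable (fun t : ℝ ↦ ‖weilMellin g (1 / 2 + t * I)‖ ^ 2) μ ∧
        weilQuadratic g = ((∫ t, ‖weilMellin g (1 / 2 + t * I)‖ ^ 2 ∂μ : ℝ) : ℂ))
    {u f : ℝ → ℂ} (hu : IsWindowFunction a u) (hf : ContDiff ℝ ∞ f) (huf : ∀ x ∈ Icc (-a) a, u x = f x) :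
    Integrable (fun t : ℝ ↦ ‖weilMellin u (1 / 2 + t * I)‖ ^ 2) μ ∧
      weilWindowForm a u = ∫ t, ‖weilMellin u (1 / 2 + t * I)‖ ^ 2 ∂μ := by
  obtain ⟨hum, huz, ⟨S₀, hS₀⟩, ⟨S₁', hS₁'⟩⟩ := hu
  set S₁ := max S₁' 0 with hS₁def
  have hS₁0 : 0 ≤ S₁ := le_max_right _ _
  have hS₁ : ∀ x y, x ∈ Icc (-a) a → y ∈ Icc (-a) a → ‖u y - u x‖ ≤ S₁ * |y - x| := fun x y hx hy ↦
    (hS₁' x y hx hy).trans (mul_le_mul_of_nonneg_right (le_max_left _ _) (abs_nonneg _))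
  have hS₀0 : 0 ≤ S₀ := (norm_nonneg _).trans (hS₀ 0)
  obtain ⟨C, hC0, hC⟩ := exists_lipschitz_smoothTransition
  -- transition widths `ε_k = a/(2(k+2)) → 0`, `2ε_k ≤ a` (as in `WeilFormatCWindowClosure`)
  set ε : ℕ → ℝ := fun k ↦ a / ((k : ℝ) + 2) / 2 with hεdef
  have hε : ∀ k, 0 < ε k := fun k ↦ by positivity
  have h2ε : ∀ k, 2 * ε k ≤ a := fun k ↦ by
    have : a / ((k : ℝ) + 2) ≤ a := div_le_self ha.le (by linarith [(Nat.cast_nonneg k : (0 : ℝ) ≤ k)])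
    show 2 * (a / ((k : ℝ) + 2) / 2) ≤ a
    linarith
  have hεto : Tendsto ε atTop (𝓝 0) := by
    have h1 : Tendsto (fun k : ℕ ↦ a / ((k : ℝ) + 2)) atTop (𝓝 0) :=
      tendsto_const_nhds.div_atTop (tendsto_atTop_add_const_right _ _ tendsto_natCast_atTop_atTop)
    simpa [hεdef] using h1.div_const 2
  choose η hηs hη01 hη1 hη0 hηL using fun k ↦ exists_smooth_plateau (a := a) (hε k) hC
  have hηm : ∀ k, Measurable (η k) := fun k ↦ (hηs k).continuous.measurable
  -- the approximants `g_k = η_k · f = η_k · u ∈ C(a)`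
  set g : ℕ → ℝ → ℂ := fun k x ↦ (η k x : ℂ) * f x with hgdef
  have hgu : ∀ k x, g k x = (η k x : ℂ) * u x := by
    intro k x
    by_cases hx : x ∈ Icc (-a) a
    · simp only [hgdef, huf x hx]
    · have hxa : a - ε k ≤ |x| := by
        have : a < |x| := lt_abs_of_not_mem_Icc_window hx
        linarith [hε k]
      simp only [hgdef, hη0 k x hxa, Complex.ofReal_zero, zero_mul]
  have hgu' : ∀ k, g k = fun x ↦ (η k x : ℂ) * u x := fun k ↦ funext (hgu k)
  have hgz : ∀ k x, x ∉ Icc (-a) a → g k x = 0 := fun k x hx ↦ by rw [hgu, huz x hx, mul_zero]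
  have hgb : ∀ k x, ‖g k x‖ ≤ S₀ := fun k x ↦ by
    rw [hgu, norm_mul, Complex.norm_real, Real.norm_eq_abs, abs_of_nonneg (hη01 k x).1]
    calc η k x * ‖u x‖ ≤ 1 * S₀ := by
          gcongr
          · exact (hη01 k x).2
          · exact hS₀ x
      _ = S₀ := one_mul _
  have hofR : ContDiff ℝ ∞ (fun x : ℝ ↦ (x : ℂ)) := Complex.ofRealCLM.contDiff
  have hgsmooth : ∀ k, ContDiff ℝ ∞ (g k) := fun k ↦ (hofR.comp (hηs k)).mul hf
  have hgm : ∀ k, Measurable (g k) := fun k ↦ (hgsmooth k).continuous.measurable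
  have hgsupp : ∀ k, tsupport (g k) ⊆ Icc (-a) a := fun k ↦
    closure_minimal (fun x hx ↦ by_contra fun h ↦ hx (hgz k x h)) isClosed_Icc
  have hgtest : ∀ k, IsWeilTest (g k) := fun k ↦
    ⟨hgsmooth k, HasCompactSupport.intro isCompact_Icc (hgz k)⟩
  -- almost-everywhere convergence `g_k → u` (everywhere off `{a, −a}`)
  have hpt : ∀ᵐ x : ℝ, Tendsto (fun k ↦ g k x) atTop (𝓝 (u x)) := by
    have hnull : ∀ᵐ x : ℝ, x ∈ ({a, -a} : Set ℝ)ᶜ :=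
      compl_mem_ae_iff.2 ((Set.toFinite _).measure_zero _)
    refine hnull.mono fun x hx ↦ ?_
    simp only [mem_compl_iff, mem_insert_iff, mem_singleton_iff, not_or] at hx
    rcases lt_or_ge a |x| with hxa | hxa
    · have hx' : x ∉ Icc (-a) a := fun h ↦ by
        have := abs_le.2 ⟨h.1, h.2⟩; linarith
      rw [huz x hx']
      exact tendsto_const_nhds.congr' (Eventually.of_forall fun k ↦ (hgz k x hx').symm)
    · have hlt : |x| < a := lt_of_le_of_ne hxa fun h ↦ by
        rcases (abs_eq ha.le).1 h with h' | h'
        · exact hx.1 h'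
        · exact hx.2 h'
      have hr : (0 : ℝ) < (a - |x|) / 2 := by linarith
      have hev : ∀ᶠ k in atTop, u x = g k x := by
        filter_upwards [hεto.eventually (gt_mem_nhds hr)] with k hk
        rw [hgu, hη1 k x (by linarith), Complex.ofReal_one, one_mul]
      exact tendsto_const_nhds.congr' hev
  -- (Q) `weilWindowForm a g_k → weilWindowForm a u` (the uniform increment bound of the closure file)
  have hQlim : Tendsto (fun k ↦ weilWindowForm a (g k)) atTop (𝓝 (weilWindowForm a u)) := by
    set Lam : ℝ := a * S₁ + 2 * C * S₀ with hLam
    set K₁ : ℝ := 4 * a * S₁ ^ 2 + 4 * S₀ ^ 2 + 8 * (2 * Lam ^ 2 + 10 * S₀ ^ 2) with hK₁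
    set K₂ : ℝ := 8 * a * S₀ ^ 2 with hK₂
    set cst : ℝ := max (K₁ / 2) (K₂ / (8 * a)) with hcst
    have hdom : ∀ k t, 0 < t → weilIncrement (g k) t ≤ cst * (if t ≤ 1 then 2 * t else 8 * a) := by
      intro k t ht
      by_cases ht1 : t ≤ 1
      · rw [if_pos ht1]
        have hmain := weilIncrement_cutoff_le ha (hε k) (h2ε k) hum huz hS₀ hS₁ hS₁0 hC0 (hηm k) (hη01 k)
          (hη1 k) (hηL k) ht
        rw [← hgu' k] at hmain
        have ht2 : t ^ 2 ≤ t := by nlinarith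
        have h3 : 4 * a * S₁ ^ 2 * t ^ 2 ≤ 4 * a * S₁ ^ 2 * t := mul_le_mul_of_nonneg_left ht2 (by positivity)
        calc weilIncrement (g k) t ≤ K₁ * t := by
              rw [hK₁, hLam]; linarith [hmain, h3]
          _ = K₁ / 2 * (2 * t) := by ring
          _ ≤ cst * (2 * t) := by gcongr; exact le_max_left _ _
      · rw [if_neg ht1]
        calc weilIncrement (g k) t ≤ 8 * a * S₀ ^ 2 := weilIncrement_le_window_const ha.le (hgm k) (hgz k) (hgb k) t
          _ = K₂ / (8 * a) * (8 * a) := by rw [hK₂]; field_simp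
          _ ≤ cst * (8 * a) := by gcongr; exact le_max_right _ _
    have hM : IntegrableOn (fun t ↦ weilArchDensity t * (cst * (if t ≤ 1 then 2 * t else 8 * a))) (Ioi 0) := by
      have h0 := integrableOn_archBound ha.le (1 : ℝ) (0 : ℝ)
      have h1 : IntegrableOn (fun t : ℝ ↦ weilArchDensity t * (if t ≤ 1 then 2 * t else 8 * a)) (Ioi 0) :=
        h0.congr_fun (fun t _ ↦ by norm_num) measurableSet_Ioi
      exact IntegrableOn.congr_fun (h1.const_mul cst) (fun t _ ↦ by ring) measurableSet_Ioi
    exact tendsto_weilWindowForm_of_ae_tendsto_of_le hgm hgz hgb hpt hM hdom a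
  -- for each `k`: `weilWindowForm a g_k = Re Q(g_k) = ∫ ‖ĝ_k‖² dμ`
  set F : (ℝ → ℂ) → ℝ → ℝ := fun v t ↦ ‖weilMellin v (1 / 2 + t * I)‖ ^ 2 with hF
  have hk : ∀ k, Integrable (F (g k)) μ ∧ weilWindowForm a (g k) = ∫ t, F (g k) t ∂μ := fun k ↦ by
    obtain ⟨h1, h2⟩ := hμ (g k) (hgtest k) (hgsupp k)
    refine ⟨h1, ?_⟩
    rw [weilWindowForm_eq_re_weilQuadratic (hgtest k) (hgsupp k), h2, Complex.ofReal_re]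
  -- (μ) uniform bounds on the transforms: `‖ĝ_k‖ ≤ 2aS₀` and `|t|‖ĝ_k‖ ≤ V`
  have hf1 : Differentiable ℝ f := hf.differentiable (by simp)
  have hfd : Continuous (deriv f) := hf.continuous_deriv (by simp)
  obtain ⟨D, hD⟩ := isCompact_Icc.exists_bound_of_continuousOn (hfd.continuousOn (s := Icc (-a) a))
  have hfS : ∀ x ∈ Icc (-a) a, ‖f x‖ ≤ S₀ := fun x hx ↦ by rw [← huf x hx]; exact hS₀ x
  set V : ℝ := 4 * C * S₀ + D * (2 * a) with hV
  have hVk : ∀ k (t : ℝ), |t| * ‖weilMellin (g k) (1 / 2 + t * I)‖ ≤ V := by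
    intro k t
    have hint : Integrable fun x ↦ ‖deriv (g k) x‖ :=
      ((hgtest k).deriv.1.continuous.norm).integrable_of_hasCompactSupport (hgtest k).deriv.2.norm
    have h := integral_norm_deriv_cutoff_le (hε k) (h2ε k) ((hηs k).differentiable (by simp)) (hη01 k)
      (hη1 k) (hη0 k) (by positivity : 0 ≤ 2 * C / ε k) (hηL k) hf1 hfS hD hint
    have e : 2 * C / ε k * S₀ * (2 * ε k) = 4 * C * S₀ := by
      have hεk := (hε k).ne'
      field_simp
      ring
    rw [e] at h
    exact (abs_mul_norm_weilMellin_le (hgtest k) t).trans h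
  have hvol : (volume (Icc (-a) a)).toReal = 2 * a := by
    rw [Real.volume_Icc, ENNReal.toReal_ofReal (by linarith)]; ring
  have hPk : ∀ k (t : ℝ), ‖weilMellin (g k) (1 / 2 + t * I)‖ ≤ S₀ * (2 * a) := by
    intro k t
    refine (norm_weilMellin_line_le_integral_norm (hgtest k).1.continuous (hgtest k).2 t).trans ?_
    rw [← setIntegral_eq_integral_of_forall_compl_eq_zero (s := Icc (-a) a)
      (fun x hx ↦ by rw [hgz k x hx, norm_zero]), ← hvol]
    have h := norm_setIntegral_le_of_norm_le_const (μ := volume) (s := Icc (-a) a) (f := fun x ↦ ‖g k x‖)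
      (C := S₀) (by rw [Real.volume_Icc]; exact ENNReal.ofReal_lt_top) fun x _ ↦ by
        rw [norm_norm]; exact hgb k x
    exact (Real.le_norm_self _).trans h
  set B : ℝ := 2 * max ((S₀ * (2 * a)) ^ 2) (V ^ 2) with hB
  have hdomμ : ∀ k t, F (g k) t ≤ B * (1 + t ^ 2)⁻¹ := fun k t ↦
    sq_norm_le_of_le_of_abs_mul_le (hPk k t) (hVk k t)
  -- pointwise convergence of the transforms
  have hptM : ∀ t : ℝ, Tendsto (fun k ↦ weilMellin (g k) (1 / 2 + t * I)) atTop
      (𝓝 (weilMellin u (1 / 2 + t * I))) := fun t ↦ by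
    unfold weilMellin
    exact tendsto_integral_mul_of_ae_tendsto (by fun_prop) hgm hgz hgb hpt
  have hptF : ∀ t : ℝ, Tendsto (fun k ↦ F (g k) t) atTop (𝓝 (F u t)) := fun t ↦
    ((hptM t).norm).pow 2
  -- the limit density is measurable and dominated, hence integrable
  have hFm : ∀ k, AEStronglyMeasurable (F (g k)) μ := fun k ↦ by
    have h1 : Continuous fun t : ℝ ↦ (1 / 2 : ℂ) + t * I := by fun_prop
    exact (((continuous_weilMellin (hgtest k).1.continuous (hgtest k).2).comp h1).norm.pow 2).aestronglyMeasurable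
  have hFum : AEStronglyMeasurable (F u) μ :=
    aestronglyMeasurable_of_tendsto_ae atTop hFm (ae_of_all _ hptF)
  have hBi : Integrable (fun t : ℝ ↦ B * (1 + t ^ 2)⁻¹) μ := (integrable_inv_one_add_sq ha hμ).const_mul B
  have hFu_le : ∀ t, F u t ≤ B * (1 + t ^ 2)⁻¹ := fun t ↦
    le_of_tendsto' (hptF t) fun k ↦ hdomμ k t
  have hF0 : ∀ v t, 0 ≤ F v t := fun v t ↦ by positivity
  have hFui : Integrable (F u) μ :=
    hBi.mono' hFum (ae_of_all _ fun t ↦ by rw [Real.norm_of_nonneg (hF0 u t)]; exact hFu_le t)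
  -- dominated convergence on the μ-side and conclusion
  have hμlim : Tendsto (fun k ↦ ∫ t, F (g k) t ∂μ) atTop (𝓝 (∫ t, F u t ∂μ)) :=
    tendsto_integral_of_dominated_convergence (fun t ↦ B * (1 + t ^ 2)⁻¹) hFm hBi
      (fun k ↦ ae_of_all _ fun t ↦ by rw [Real.norm_of_nonneg (hF0 _ t)]; exact hdomμ k t)
      (ae_of_all _ hptF)
  refine ⟨hFui, tendsto_nhds_unique hQlim ?_⟩
  exact hμlim.congr' (Eventually.of_forall fun k ↦ (hk k).2.symm)

/-! ## Format C: the Gram matrix is a moment matrix of `μ` -/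

/-- **Trigonometric windows.**  For every finite set of modes `s` and coefficients `c`, the window form of
`Σ_{n∈s} c_n χ_n` is `∫ ‖(Σ c_n χ_n)^(½+it)‖² dμ(t)` (integrand in `L¹(μ)`). -/
theorem weilWindowForm_sum_smul_chi_eq_integral (ha : 0 < a) {μ : Measure ℝ}
    (hμ : ∀ g : ℝ → ℂ, IsWeilTest g → tsupport g ⊆ Icc (-a) a →
      Integrable (fun t : ℝ ↦ ‖weilMellin g (1 / 2 + t * I)‖ ^ 2) μ ∧
        weilQuadratic g = ((∫ t, ‖weilMellin g (1 / 2 + t * I)‖ ^ 2 ∂μ : ℝ) : ℂ))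
    (s : Finset ℤ) (c : ℤ → ℂ) :
    Integrable (fun t : ℝ ↦ ‖weilMellin (∑ n ∈ s, c n • Yoshida1992.chi a n) (1 / 2 + t * I)‖ ^ 2) μ ∧
      weilWindowForm a (∑ n ∈ s, c n • Yoshida1992.chi a n) =
        ∫ t, ‖weilMellin (∑ n ∈ s, c n • Yoshida1992.chi a n) (1 / 2 + t * I)‖ ^ 2 ∂μ := by
  refine weilWindowForm_eq_integral ha hμ (f := fun x ↦ ∑ n ∈ s, c n • Yoshida1992.chiCore a n x)
    (IsWindowFunction.sum s c fun n _ ↦ isWindowFunction_chi ha n)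
    (ContDiff.sum fun n _ ↦ (Yoshida1992.contDiff_chiCore a n).const_smul (c n)) fun x hx ↦ ?_
  simp only [Finset.sum_apply, Pi.smul_apply, Yoshida1992.chi, indicator_of_mem hx]

/-- **Yoshida's Gram matrix is a moment matrix of every representing measure.**  For `a > 0`, every measure
`μ` representing Weil's form on the tests of `[-a, a]`, every finite `s ⊆ ℤ` and every real vector `x`:

  `Σ_{n,m∈s} x_n x_m · gramCoeff a n m = ∫ ‖Σ_{n∈s} x_n χ̂_n(½+it)‖² dμ(t)`.

So a format-C certificate (all truncations PSD) tests exactly the positivity of a measure on the span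
of the window's trigonometric system on the critical line, and a negative truncation says that no positive
measure has these moments. -/
theorem sum_mul_mul_gramCoeff_eq_integral (ha : 0 < a) {μ : Measure ℝ}
    (hμ : ∀ g : ℝ → ℂ, IsWeilTest g → tsupport g ⊆ Icc (-a) a →
      Integrable (fun t : ℝ ↦ ‖weilMellin g (1 / 2 + t * I)‖ ^ 2) μ ∧
        weilQuadratic g = ((∫ t, ‖weilMellin g (1 / 2 + t * I)‖ ^ 2 ∂μ : ℝ) : ℂ))
    (s : Finset ℤ) (x : ℤ → ℝ) :
    ∑ n ∈ s, ∑ m ∈ s, x n * x m * Yoshida1992.gramCoeff a n m =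
      ∫ t, ‖weilMellin (∑ n ∈ s, (x n : ℂ) • Yoshida1992.chi a n) (1 / 2 + t * I)‖ ^ 2 ∂μ := by
  have h := (weilWindowForm_sum_smul_chi_eq_integral ha hμ s (fun n ↦ (x n : ℂ))).2
  rw [weilWindowForm_sum_smul_chi_eq_gramCoeff ha] at h
  rw [← h]
  refine Finset.sum_congr rfl fun n _ ↦ Finset.sum_congr rfl fun m _ ↦ ?_
  rw [Complex.conj_ofReal, ← Complex.ofReal_mul, Complex.ofReal_re]

/-- **A rung is a moment problem.**  For `a > 0`: `WeilPositivityOn a` holds iff there is a positive measure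
`μ` on `ℝ` whose trigonometric moments are Yoshida's Gram matrix,
`Σ_{n,m∈s} x_n x_m · gramCoeff a n m = ∫ ‖Σ x_n χ̂_n(½+it)‖² dμ` for all finite `s ⊆ ℤ` and real `x`
(`→`: the Bochner–Kreĭn measure and `sum_mul_mul_gramCoeff_eq_integral`; `←`: every truncation is then
PSD, `weilPositivityOn_of_gramCoeff_psd`). -/
theorem weilPositivityOn_iff_exists_moment_measure (ha : 0 < a) :
    WeilPositivityOn a ↔ ∃ μ : Measure ℝ, ∀ (s : Finset ℤ) (x : ℤ → ℝ),
      ∑ n ∈ s, ∑ m ∈ s, x n * x m * Yoshida1992.gramCoeff a n m =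
        ∫ t, ‖weilMellin (∑ n ∈ s, (x n : ℂ) • Yoshida1992.chi a n) (1 / 2 + t * I)‖ ^ 2 ∂μ := by
  constructor
  · intro hW
    obtain ⟨μ, -, hμ⟩ := WeilBochner.exists_measure_of_weilPositivityOn ha hW
    exact ⟨μ, fun s x ↦ sum_mul_mul_gramCoeff_eq_integral ha hμ s x⟩
  · rintro ⟨μ, hμ⟩
    refine weilPositivityOn_of_gramCoeff_psd ha fun N x ↦ ?_
    rw [hμ]
    exact integral_nonneg fun t ↦ by positivity

end Summit.RiemannHypothesis.RiemannHypothesis.Theorems.WeilBochnerMeasure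

end
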